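import Summits.ResolutionOfSingularities.ResolutionOfSingularities.Theorems.WildQuotientsWildQuotientResolutionS1aGameFrameWF

/-!
# S1a — H4e-WF-From: a strategy RELATIVE TO AN INVARIANT along the play from the initial model
[OURS · L1 W4.5c · tri-1 g5 (lens CYCLING / vacuity); comment on plan-1's SKELETON v4 «GLOBAL FRAME» 2026-08-27T22:37:11Z]

NOT a statement of the manuscript; counted 0. AI-level work, weaker than expert review.

`StrategyWF` quantifies over ALL `GModel`s: it asserts that EVERY non-terminal proper birational integral G-model with a
tame node atlas admits an admissible centre with a μ-decreasing move. A strategy only has to handle the models that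
actually occur in the play from the initial model, and a termination measure with a HISTORY component (plan-1's ν₀,
exceptional age) is not a function of the bare model. `StrategyWFFrom M₀` asks for an invariant `P` with `P M₀`,
preserved by the chosen moves, and the admissible μ-decreasing move only for models satisfying `P`.

* `StrategyWFFrom p q G ρ g₀ M₀` — ∃ well-founded `α`, `μ`, invariant `P ∋ M₀`: every non-terminal `P`-model has an
  admissible centre all of whose moves stay in `P` and decrease `μ`;
* `strategyWFFrom_of_strategyWF : StrategyWF → StrategyWFFrom M₀` (`P := fun _ => True`);
* **`killTameModel_of_wfFrom` / `killTameModel_of_blowupNodeAtlas_wfFrom`** — the capstone from the weaker hypothesis,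
  same well-founded induction carrying `P`.
-/

set_option linter.dupNamespace false

noncomputable section

open CategoryTheory AlgebraicGeometry TopologicalSpace
open Literature.AlgebraicGeometry.Resolution Literature.AlgebraicGeometry.RelativeSpec
open Summit.ResolutionOfSingularities.ResolutionOfSingularities.Theorems.WildQuotientResolution.S1
open Summit.ResolutionOfSingularities.ResolutionOfSingularities.Theorems.WildQuotientResolution.S1.NodeAtlas
open Summit.ResolutionOfSingularities.ResolutionOfSingularities.Theorems.WildQuotientResolution.S1.MoveStep
open Summit.ResolutionOfSingularities.ResolutionOfSingularities.Theorems.WildQuotientResolution.S1.CentreNeBot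

namespace Summit.ResolutionOfSingularities.ResolutionOfSingularities.Theorems.WildQuotientResolution.S1.GameFrame

variable (p : ℕ) {X' X₁ : Scheme.{0}} (q : X' ⟶ X₁) (G : Type) [Group G] (ρ : G →* Aut X') (g₀ : G)

/-- **(G6-WF-From) STRATEGY relative to an invariant `P` holding at `M₀` and preserved by the chosen moves.**
[OURS · L1 W4.5c · tri-1] — NOT a statement of the manuscript. -/
def StrategyWFFrom (M₀ : GModel p q G ρ g₀) : Prop :=
  ∃ (α : Type) (_ : LT α) (_ : WellFoundedLT α) (μ : GModel p q G ρ g₀ → α) (P : GModel p q G ρ g₀ → Prop),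
    P M₀ ∧ ∀ M : GModel p q G ρ g₀, P M → ¬ M.Terminal →
      ∃ (𝒦 : ReesFiltration M.V) (d : ℕ), IsAdmissibleCentre p M.act g₀ 𝒦 d ∧
        ∀ M' : GModel p q G ρ g₀, M.IsMoveOf M' 𝒦 d → P M' ∧ μ M' < μ M

variable {p q G ρ g₀}

/-- An absolute well-founded strategy is a relative one (`P := ⊤`). -/
theorem strategyWFFrom_of_strategyWF (h : StrategyWF p q G ρ g₀) (M₀ : GModel p q G ρ g₀) :
    StrategyWFFrom p q G ρ g₀ M₀ := by
  obtain ⟨α, _, hwf, μ, hμ⟩ := h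
  refine ⟨α, inferInstance, hwf, μ, fun _ => True, trivial, fun M _ hT => ?_⟩
  obtain ⟨𝒦, d, h𝒦, hdec⟩ := hμ M hT
  exact ⟨𝒦, d, h𝒦, fun M' hM' => ⟨trivial, hdec M' hM'⟩⟩

/-- **The `KillTameModel` ASSEMBLY from a relative well-founded strategy** — well-founded induction on `μ M` over the
models satisfying the invariant `P`. -/
theorem killTameModel_of_wfFrom [Finite G] [X₁.IsSeparated] [IsSeparated q]
    (hG : ∀ g : G, g ∈ Subgroup.zpowers g₀) (hmove : MoveStep.{0} p) (hend : EndGluing)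
    {M₀ : GModel p q G ρ g₀} (hstrat : StrategyWFFrom p q G ρ g₀ M₀) : KillTameModel q G ρ := by
  obtain ⟨α, _, hwf, μ, P, hP₀, hμ⟩ := hstrat
  suffices h : ∀ a : α, ∀ M : GModel p q G ρ g₀, P M → μ M = a → KillTameModel q G ρ from h (μ M₀) M₀ hP₀ rfl
  intro a
  induction a using hwf.induction with
  | _ a ih =>
    intro M hPM ha
    by_cases hT : M.Terminal
    · exact killTameModel_of_terminal hend M hT
    · obtain ⟨𝒦, d, h𝒦, hdec⟩ := hμ M hPM hT
      obtain ⟨M', hM'⟩ := exists_isMoveOf hmove hG M h𝒦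
      exact ih (μ M') (ha ▸ (hdec M' hM').2) M' (hdec M' hM').1 rfl

/-- … and from the chart residue (G1). -/
theorem killTameModel_of_blowupNodeAtlas_wfFrom [Finite G] [X₁.IsSeparated] [IsSeparated q]
    (hG : ∀ g : G, g ∈ Subgroup.zpowers g₀) (hcharts : BlowupNodeAtlas.{0} p) (hend : EndGluing)
    {M₀ : GModel p q G ρ g₀} (hstrat : StrategyWFFrom p q G ρ g₀ M₀) : KillTameModel q G ρ :=
  killTameModel_of_wfFrom hG (moveStep_of_blowupNodeAtlas hcharts) hend hstrat

end Summit.ResolutionOfSingularities.ResolutionOfSingularities.Theorems.WildQuotientResolution.S1.GameFrame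

end
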